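import Summits.QuantumFields.YangMills.Theorems.BalabanUVNodesN22NestedPolymersDefs
import Summits.QuantumFields.YangMills.Theorems.BalabanUVNodesN22NestedPolymersKP

/-!
# THE NESTED-POLYMERS TOWER — THE (2.13) TERMS OF THE NESTED STEP IN CLOSED FORM (A6 lane, dag-n22-w3): `E(seg j) = log Z(seg 0..seg j) − log Z(seg 0..seg (j−1)) =
# log(1 + x·Σ_{i ≤ j} a i g) − log(1 + x·Σ_{i < j} a i g)` through def-W1's `W1.ClusterStep.E` = `B13Resummation.locE` on def-T's catalogue with `TTouch`

Cell `pub-ymgap`, Track A (HUMAN RULING D-0062), WIDTH SEAT `dag-n22-w3` g5 on node n22 = NE9, A6-residue lane; `--kind proof --supports stmt-QuantumFields-27366 --as helper` (KEY MAP v2: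
K3⁸), COUNT-NEUTRAL; THEOREMS ONLY (0 `def`, 0 `sorry`, standard axioms).  Objects: `…N22NestedPolymersDefs` (this seat; `segCubes`, `segDom`, `nestedStep`, `originReading`, `nestedTower`);
engine: `…N22NestedPolymersKP` (this seat; KP for pairwise-incompatible families, the `locE` chain lemma, the on-site Hessian).

* §0 `hasDerivAt_log_one_add_mul_exp` ∕ `hasDerivAt_deriv_log_one_add_mul_exp` (`f u = log(1 + A u)`: `(f ∘ exp)″(0) = A∕(1+A)² =: ψ(A)`), `abs_psi_sub_psi_le` (`|ψ(A) − ψ(B)| ≤ |A − B|`,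
  the tail estimate's heart), `psi_lt_psi` (`ψ` strictly increasing on `[0, 1]`), `cap_spec` (the tower's cap fits the torus), `originReading_fst`, ★ `exists_threshold_domCount` (the torus
  outgrows the chain: `K + 2 ≤` cubes per direction of `T^{(k+1)}_K` from some `K₁(k)` on — `L^K` beats `(K+2)·L^{k+1}M`, `tendsto_self_mul_const_pow_of_lt_one`).
* §1 the polymers below the volume threshold (`m + 1 ≤ n` cubes per direction): `segPt_injOn`, `le_of_mem_range_of_le`, `card_segCubes` (`seg i` has `i + 1` cubes), `segCubes_injOn` ∕
  `segDom_injOn` (pairwise distinct), `le_of_segCubes_subset` (the chain is strict), `ttouch_segDom` (they pairwise TOUCH — share the cube `0` — i.e. are pairwise INCOMPATIBLE polymers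
  of [II] (2.11)).
* §2 the activity of the nested step: `H_nestedStep_segDom` (`H(seg j) = a j g · 𝐔(b₀)`), `H_nestedStep_eq_zero` (every other polymer has activity `0`), `nestedStep_mono`.
* §3 ★★ `E_nestedStep_segDom` (the (2.13) term of `seg j` = the difference of the Kotecký–Preiss logarithms of the touching families `seg 0..seg j` and `seg 0..seg (j−1)` —
  `locE_chain_eq` on `tgeometry`), ★ `E_nestedStep_eq_zero`, `polymerLogZ_nestedStep` (`log Z(seg 0..seg (j−1)) = Log(1 + 𝐔(b₀)·Σ_{i<j} a i g)`), ★★ `E_nestedStep_segDom_ofReal` (at a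
  real positive probe value `𝐔(b₀) = x`, amplitudes `a · g ≥ 0`: `E(seg j) = log(1 + x Σ_{i ≤ j} a i g) − log(1 + x Σ_{i<j} a i g)`, a real number).

HONEST FRAMING (binding).  A MODEL-LEVEL A6 witness (test activities on def-T's catalogue, scalar probe algebra `𝔄 = ℝ`, `ρ = id`, one colour; the activities read the probe
configuration at ONE bond, with real amplitudes that may read the young couplings): NOT Bałaban's activities (2.9)–(2.11), NOT the towers OF RECORD, NOT a reading OF RECORD; inhabits
NO letter OF RECORD; nothing of Bałaban's asserted or constructed; (1.21)'s existence for the terms OF RECORD is NOT proved; N22 NOT discharged; K3⁸ `SpineGivenEndpointR13SepCoPHV` OPEN,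
not claimed, no stub touched; counts UNMOVED (typed 28∕28 · discharged 5∕27; the chair's single count line is the only count); one finite 𝕋⁴ programme at fixed ε — R4 closes the
CONDITIONAL rung `BalabanLadder.UV` only; NOTHING about the continuum limit, ℝ⁴, OS axioms or a mass gap is proved or claimed; the Yang–Mills mass gap (Clay) is NOT proved by any of
this.  No cite tags (Summit side); TYPES only: [I] = [Balaban1987RG1] CMP **109** (1987) (1.7) p. 261, (1.20)–(1.21) p. 264; [II] = [Balaban1988RG2Cluster] CMP **116** (1988)
(2.9)–(2.14) pp. 14–15; [KP86] = Kotecký–Preiss, CMP **103** (1986) (2)–(3).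
-/

noncomputable section

open Finset Filter Topology
open scoped BigOperators

namespace YMDAG.N22.AtKernels.NestedPolymers

open Literature.Probability.LatticeModels
open Literature.MathematicalPhysics.QuantumFieldTheory.Balaban1983to89
open Literature.MathematicalPhysics.QuantumFieldTheory.Balaban1983to89.T4ActivityRecursionWitness (one_add_mul_mem_slitPlane isCompatible_singleton)
open Literature.MathematicalPhysics.QuantumFieldTheory.Balaban1983to89.B13Resummation (locE)
open Literature.MathematicalPhysics.QuantumFieldTheory.Balaban1983to89.B13FamilySum (coveringFamilies mem_coveringFamilies)
open Literature.MathematicalPhysics.QuantumFieldTheory.Balaban1983to89.TreeLengthTorus (TPt TAdj TStepIn TLinked TFaceConnected IsTDom TDom tsys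
  tadj_update_add_one)
open Literature.MathematicalPhysics.QuantumFieldTheory.Balaban1983to89.TreeLengthTorusGeometry (TTouch ttouch_symm tgeometry)
open Literature.MathematicalPhysics.QuantumFieldTheory.Balaban1983to89.T4Continuum (T4Family)
open Literature.MathematicalPhysics.QuantumFieldTheory.Balaban1983to89.Node00 (siteOfInt polScalar polWindow polLimit PolLimitExists TermFamily1)
open Literature.MathematicalPhysics.QuantumFieldTheory.Balaban1983to89.Node00.Sect2 (domSys domCount CPair)
open Literature.MathematicalPhysics.QuantumFieldTheory.Balaban1983to89.B14.Eq213MaximalDomains (side)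
open Literature.MathematicalPhysics.QuantumFieldTheory.Balaban1983to89.Node00.W1 (ClusterStep ClusterTower)
open Literature.MathematicalPhysics.QuantumFieldTheory.Balaban1983to89.Node00.LocalizedSum17 (localizedSum ReadingMaps)
open Literature.MathematicalPhysics.QuantumFieldTheory.Balaban1983to89.Node00.U3KernelLetters (PolLimitsExist)
open Literature.MathematicalPhysics.QuantumFieldTheory.Balaban1983to89.Node00.U3OfKernels (histPrefix)
open YMDAG.N18.FiniteVolumeLettersModel (bondEval bondEval_apply siteOfInt_eventually_ne)
open YMDAG.N22.AtKernels.NestedTermsModel (exists_threshold_siteOfInt)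
open Literature.MathematicalPhysics.QuantumFieldTheory.Balaban1983to89.B12PolarizationTensor120 (polTensor polComp expChart)

/-! ## §0 The logarithmic on-site weight `ψ(A) = A∕(1+A)²`; the cap; the volume threshold; the origin reading's face -/

section Weight

/-- **THE LOGARITHMIC ON-SITE WEIGHT**: for `f u = log (1 + A u)` (`0 ≤ A`), `h = f ∘ exp` has `h′ t = A e^t ∕ (1 + A e^t)`, `h″ t = A e^t ∕ (1 + A e^t)²`, so
`h″(0) = A ∕ (1 + A)²`. -/
theorem hasDerivAt_log_one_add_mul_exp {A : ℝ} (hA : 0 ≤ A) (t : ℝ) :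
    HasDerivAt (fun s => Real.log (1 + A * Real.exp s)) (A * Real.exp t / (1 + A * Real.exp t)) t := by
  have hpos : 0 < 1 + A * Real.exp t := add_pos_of_pos_of_nonneg one_pos (mul_nonneg hA (Real.exp_pos t).le)
  have h1 : HasDerivAt (fun s => 1 + A * Real.exp s) (A * Real.exp t) t := by
    simpa using ((Real.hasDerivAt_exp t).const_mul A).const_add 1
  simpa [div_eq_inv_mul] using h1.log hpos.ne'

/-- See `hasDerivAt_log_one_add_mul_exp`. -/
theorem hasDerivAt_deriv_log_one_add_mul_exp {A : ℝ} (hA : 0 ≤ A) (t : ℝ) :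
    HasDerivAt (fun s => A * Real.exp s / (1 + A * Real.exp s)) (A * Real.exp t / (1 + A * Real.exp t) ^ 2) t := by
  have hpos : 0 < 1 + A * Real.exp t := add_pos_of_pos_of_nonneg one_pos (mul_nonneg hA (Real.exp_pos t).le)
  have h1 : HasDerivAt (fun s => A * Real.exp s) (A * Real.exp t) t := (Real.hasDerivAt_exp t).const_mul A
  have h2 : HasDerivAt (fun s => 1 + A * Real.exp s) (A * Real.exp t) t := by simpa using h1.const_add 1
  have h3 := h1.div h2 hpos.ne'
  have e : A * Real.exp t * (1 + A * Real.exp t) - A * Real.exp t * (A * Real.exp t) = A * Real.exp t := by ring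
  rw [e] at h3
  exact h3

/-- The algebraic heart of the tail estimate: `|A∕(1+A)² − B∕(1+B)²| ≤ |A − B|` for `A, B ≥ 0`. -/
theorem abs_psi_sub_psi_le {A B : ℝ} (hA : 0 ≤ A) (hB : 0 ≤ B) : |A / (1 + A) ^ 2 - B / (1 + B) ^ 2| ≤ |A - B| := by
  have hA1 : 0 < 1 + A := by linarith
  have hB1 : 0 < 1 + B := by linarith
  have e : A / (1 + A) ^ 2 - B / (1 + B) ^ 2 = (A - B) * ((1 - A * B) / ((1 + A) ^ 2 * (1 + B) ^ 2)) := by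
    field_simp
    ring
  rw [e, abs_mul]
  refine mul_le_of_le_one_right (abs_nonneg _) ?_
  rw [abs_div, abs_of_pos (by positivity : (0 : ℝ) < (1 + A) ^ 2 * (1 + B) ^ 2), div_le_one (by positivity), abs_le]
  constructor <;> nlinarith [mul_nonneg hA hB, mul_nonneg (mul_nonneg hA hB) (mul_nonneg hA hB), mul_nonneg (mul_nonneg hA hA) hB, mul_nonneg hA (mul_nonneg hB hB)]

/-- `ψ(A) = A∕(1+A)²` is STRICTLY INCREASING on `[0, 1]`: `ψ(A) − ψ(B) = (A − B)(1 − AB)∕((1+A)²(1+B)²)`. -/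
theorem psi_lt_psi {A B : ℝ} (hB : 0 ≤ B) (hAB : B < A) (hA1 : A ≤ 1) : B / (1 + B) ^ 2 < A / (1 + A) ^ 2 := by
  have hA : 0 ≤ A := hB.trans hAB.le
  have hprod : A * B < 1 := by nlinarith
  rw [div_lt_div_iff₀ (by positivity) (by positivity)]
  nlinarith [mul_nonneg hA hB, mul_pos (sub_pos.2 hAB) (sub_pos.2 hprod), mul_nonneg (mul_nonneg hA hB) (mul_nonneg hA hB)]

/-- The cap fits: `min K (n − 1) + 1 ≤ n`. -/
theorem cap_spec (K n : ℕ) [NeZero n] : min K (n - 1) + 1 ≤ n := by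
  have := NeZero.one_le (n := n)
  omega

end Weight

section Family

variable {F : T4Family} {M : ℕ}

/-- The origin reading's `𝐔`-component at any bond is the probe value at `(e₀, window origin)`. -/
@[simp] theorem originReading_fst (K k : ℕ) (U : Fin (F.P K).d → Site (F.P K) (k + 1) → ℝ) (b : PBond (F.P K) 0) :
    (originReading F K k U).1 b = ((U (Fin.cast (F.P_d K).symm 0) (siteOfInt F K (k + 1) 0) : ℝ) : ℂ) := rfl

/-- **VOLUME THRESHOLD**: from some volume on, `K + 2 ≤` (cubes per direction of `T^{(k+1)}_K`) — the torus outgrows the chain (`L > 1`: `L^K` beats `(K+2)·L^{k+1}M`). -/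
theorem exists_threshold_domCount [NeZero M] (k : ℕ) : ∃ K₁ : ℕ, ∀ K, K₁ ≤ K → K + 2 ≤ domCount (F.P K) M (k + 1) := by
  have hL1 : 1 < F.L := F.hL.2
  have hLpos : 0 < F.L := by omega
  set C : ℕ := F.L ^ (k + 1) * M with hC
  have hCpos : 0 < C := Nat.mul_pos (Nat.pow_pos hLpos) (Nat.pos_of_ne_zero (NeZero.ne M))
  -- real-analysis step: `((K + 2)·C + 1) · L^{-K} → 0`
  set r : ℝ := ((F.L : ℝ))⁻¹ with hr
  have hr0 : 0 ≤ r := by rw [hr]; positivity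
  have hr1 : r < 1 := by rw [hr]; exact inv_lt_one_of_one_lt₀ (by exact_mod_cast hL1)
  have h1 : Tendsto (fun K : ℕ => (K : ℝ) * r ^ K) atTop (nhds 0) := tendsto_self_mul_const_pow_of_lt_one hr0 hr1
  have h2 : Tendsto (fun K : ℕ => r ^ K) atTop (nhds 0) := tendsto_pow_atTop_nhds_zero_of_lt_one hr0 hr1
  have h3 : Tendsto (fun K : ℕ => (C : ℝ) * ((K : ℝ) * r ^ K) + (2 * (C : ℝ) + 1) * r ^ K) atTop (nhds 0) := by
    simpa using (h1.const_mul (C : ℝ)).add (h2.const_mul (2 * (C : ℝ) + 1))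
  obtain ⟨K₁, hK₁⟩ := eventually_atTop.1 (Filter.Tendsto.eventually_lt_const zero_lt_one h3)
  refine ⟨K₁, fun K hK => ?_⟩
  have hlt : ((K + 2) * C + 1 : ℝ) * r ^ K < 1 := by
    have := hK₁ K hK
    have e : ((K + 2) * C + 1 : ℝ) * r ^ K = (C : ℝ) * ((K : ℝ) * r ^ K) + (2 * (C : ℝ) + 1) * r ^ K := by ring
    rw [e]; exact this
  -- hence `(K + 2)·C + 1 ≤ L^K ≤ 2 L^{m+K} − 1`
  have hLK : (0 : ℝ) < (F.L : ℝ) ^ K := by positivity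
  have hrL : r ^ K * (F.L : ℝ) ^ K = 1 := by rw [hr, inv_pow, inv_mul_cancel₀ hLK.ne']
  have hnat : (K + 2) * C + 1 ≤ F.L ^ K := by
    have : ((K + 2) * C + 1 : ℝ) < (F.L : ℝ) ^ K := by
      have := mul_lt_mul_of_pos_right hlt hLK
      rwa [mul_assoc, hrL, mul_one, one_mul] at this
    exact_mod_cast this.le
  have hpow : F.L ^ K ≤ 2 * F.L ^ (F.m + K) - 1 := by
    have h₁ : F.L ^ K ≤ F.L ^ (F.m + K) := Nat.pow_le_pow_right hLpos (by omega)
    have h₂ : 1 ≤ F.L ^ (F.m + K) := Nat.one_le_pow _ _ hLpos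
    omega
  have hside : side (F.P K).L M (k + 1) = C := by rw [hC, T4Family.P_L]; rfl
  show K + 2 ≤ ((F.P K).sitesPerDir 0 - 1) / side (F.P K).L M (k + 1) + 1
  rw [T4Family.sitesPerDir_eq, hside]
  have : K + 1 ≤ (2 * F.L ^ (F.m + K) - 1) / C := (Nat.le_div_iff_mul_le hCpos).2 (by nlinarith)
  omega

end Family

/-! ## §1 The nested polymers below the volume threshold -/

section Segments

variable {d n : ℕ}

/-- Distinct indices below `n` give distinct cubes `j·e`. -/
theorem segPt_injOn (l₀ : Fin d) : Set.InjOn (fun j : ℕ => (segPt l₀ j : TPt d n)) {j | j < n} := by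
  intro j hj j' hj' h
  have := congrFun h l₀
  simp only [segPt, Function.update_self] at this
  have h1 := congrArg ZMod.val this
  rwa [ZMod.val_natCast, ZMod.val_natCast, Nat.mod_eq_of_lt hj, Nat.mod_eq_of_lt hj'] at h1

/-- Index bookkeeping: a member of `range j`, `j ≤ m + 1`, is `≤ m`. -/
theorem le_of_mem_range_of_le {i j m : ℕ} (hi : i ∈ Finset.range j) (hj : j ≤ m + 1) : i ≤ m := by
  have := Finset.mem_range.1 hi
  omega

/-- Below the volume threshold (`i + 1 ≤ n`) the `i`-th polymer has exactly `i + 1` cubes. -/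
theorem card_segCubes (l₀ : Fin d) {i : ℕ} (hi : i + 1 ≤ n) : (segCubes n l₀ i).card = i + 1 := by
  unfold segCubes
  rw [Finset.card_image_of_injOn, Finset.card_range]
  exact (segPt_injOn l₀).mono fun j hj => lt_of_lt_of_le (Finset.mem_range.1 (Finset.mem_coe.1 hj)) hi

/-- Below the volume threshold the nested polymers are pairwise distinct and strictly increasing. -/
theorem segCubes_injOn (l₀ : Fin d) {m : ℕ} (hm : m + 1 ≤ n) : Set.InjOn (fun i : ℕ => segCubes n l₀ i) {i | i ≤ m} := by
  intro i hi i' hi' h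
  have hi1 : i ≤ m := hi
  have hi2 : i' ≤ m := hi'
  have hc := congrArg Finset.card h
  simp only at hc
  rw [card_segCubes l₀ (by omega), card_segCubes l₀ (by omega)] at hc
  omega

/-- A polymer contained in `seg i'` that is itself a `seg i` (`i, i' ≤ m < n`) has `i ≤ i'`. -/
theorem le_of_segCubes_subset (l₀ : Fin d) {m i i' : ℕ} (hm : m + 1 ≤ n) (hi : i ≤ m) (hi' : i' ≤ m)
    (h : segCubes n l₀ i ⊆ segCubes n l₀ i') : i ≤ i' := by
  have := Finset.card_le_card h
  rw [card_segCubes l₀ (by omega), card_segCubes l₀ (by omega)] at this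
  omega

variable [NeZero n]

/-- … hence the polymer DOMAINS `segDom 0, …, segDom m` are pairwise distinct (`m + 1 ≤ n`). -/
theorem segDom_injOn (l₀ : Fin d) {m : ℕ} (hm : m + 1 ≤ n) : Set.InjOn (fun i : ℕ => segDom n l₀ i) {i | i ≤ m} :=
  fun _ hi _ hi' h => segCubes_injOn l₀ hm hi hi' (congrArg Subtype.val h)

/-- Nested polymers TOUCH (they share the cube `0`). -/
theorem ttouch_segDom (l₀ : Fin d) (i i' : ℕ) : TTouch (segDom n l₀ i) (segDom n l₀ i') :=
  ⟨0, zero_mem_segCubes l₀ i, 0, zero_mem_segCubes l₀ i', Or.inl rfl⟩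

end Segments

/-! ## §2 The activity of the nested step -/

section Tower

variable {P : Params} {M k : ℕ}

/-- The activity of the nested step at the `j`-th polymer is `a j g · 𝐔(b₀)` (below the volume threshold `m + 1 ≤` cubes per direction). -/
theorem H_nestedStep_segDom (l₀ : Fin P.d) (a : ℕ → (Fin (k + 1) → ℝ) → ℝ) {m : ℕ} (hm : m + 1 ≤ domCount P M (k + 1)) (g : Fin (k + 1) → ℝ) (φ : CPair P ℂ)
    {j : ℕ} (hj : j ≤ m) :
    (nestedStep P M k l₀ a m).H g φ (segDom (domCount P M (k + 1)) l₀ j) = (a j g : ℂ) * φ.1 ⟨default, l₀⟩ := by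
  classical
  unfold ClusterStep.H nestedStep
  simp only
  have hf : ((Finset.range (m + 1)).filter fun i => segDom (domCount P M (k + 1)) l₀ i = segDom (domCount P M (k + 1)) l₀ j) = {j} := by
    ext i
    simp only [Finset.mem_filter, Finset.mem_range, Finset.mem_singleton]
    constructor
    · rintro ⟨hi, h⟩
      exact segDom_injOn l₀ hm (show i ≤ m by omega) hj h
    · rintro rfl
      exact ⟨by omega, rfl⟩
  rw [show (Finset.filter (fun i => segDom (domCount P M (k + 1)) l₀ i = segDom (domCount P M (k + 1)) l₀ j) (Finset.range (m + 1))) = {j} from ?_,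
    Finset.sum_singleton]
  convert hf using 2

/-- The activity of the nested step VANISHES at every polymer other than `segDom 0, …, segDom m`. -/
theorem H_nestedStep_eq_zero (l₀ : Fin P.d) (a : ℕ → (Fin (k + 1) → ℝ) → ℝ) (m : ℕ) (g : Fin (k + 1) → ℝ) (φ : CPair P ℂ)
    {Z : (domSys P M (k + 1)).Dom} (hZ : ∀ i ≤ m, Z ≠ segDom (domCount P M (k + 1)) l₀ i) :
    (nestedStep P M k l₀ a m).H g φ Z = 0 := by
  classical
  unfold ClusterStep.H nestedStep
  simp only
  refine Finset.sum_eq_zero fun i hi => ?_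
  exfalso
  have hi' := hi
  simp only [Finset.mem_filter, Finset.mem_range] at hi'
  exact hZ i (by omega) hi'.2.symm

/-- The chain hypotheses of `locE_chain_eq` ∕ `locE_chain_eq_zero` hold for the nested step below the volume threshold. -/
theorem nestedStep_mono (l₀ : Fin P.d) {m : ℕ} (hm : m + 1 ≤ domCount P M (k + 1)) :
    ∀ i ≤ m, ∀ i' ≤ m, ((tgeometry P.d (domCount P M (k + 1))).cubes (segDom (domCount P M (k + 1)) l₀ i) ⊆
      (tgeometry P.d (domCount P M (k + 1))).cubes (segDom (domCount P M (k + 1)) l₀ i') ↔ i ≤ i') :=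
  fun _ hi _ hi' => ⟨le_of_segCubes_subset l₀ hm hi hi', segCubes_mono l₀⟩

end Tower

/-! ## §3 The (2.13) terms of the nested step in closed form -/

section Terms

variable {P : Params} {M k : ℕ}

open Classical in
/-- ★ **THE (2.13) TERM OF THE `j`-TH NESTED POLYMER** (`j ≤ m`, below the volume threshold): `E(seg j) = log Z(seg 0, …, seg j) − log Z(seg 0, …, seg (j−1))`,
the Kotecký–Preiss logarithms of the touching families — by `locE_chain_eq` on def-T's catalogue with `TTouch`. -/
theorem E_nestedStep_segDom (l₀ : Fin P.d) (a : ℕ → (Fin (k + 1) → ℝ) → ℝ) {m : ℕ} (hm : m + 1 ≤ domCount P M (k + 1)) (g : Fin (k + 1) → ℝ) (φ : CPair P ℂ)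
    {j : ℕ} (hj : j ≤ m) :
    (nestedStep P M k l₀ a m).E g φ (segDom (domCount P M (k + 1)) l₀ j) =
      polymerLogZ (TTouch (d := P.d) (N := domCount P M (k + 1))) (fun Z => (nestedStep P M k l₀ a m).H g φ Z)
          ((Finset.range (j + 1)).image (segDom (domCount P M (k + 1)) l₀)) -
        polymerLogZ (TTouch (d := P.d) (N := domCount P M (k + 1))) (fun Z => (nestedStep P M k l₀ a m).H g φ Z)
          ((Finset.range j).image (segDom (domCount P M (k + 1)) l₀)) := by
  haveI : Std.Symm (tgeometry P.d (domCount P M (k + 1))).ι := ⟨ttouch_symm⟩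
  unfold ClusterStep.E
  exact locE_chain_eq (ι := (tgeometry P.d (domCount P M (k + 1))).ι) (tgeometry P.d (domCount P M (k + 1))).cubes _
    (segDom (domCount P M (k + 1)) l₀) m (segDom_injOn l₀ hm) (fun Z hZ => H_nestedStep_eq_zero l₀ a m g φ hZ) (nestedStep_mono l₀ hm)
    (fun i _ => segCubes_nonempty l₀ i) hj

/-- **EVERY OTHER (2.13) TERM OF THE NESTED STEP VANISHES.** -/
theorem E_nestedStep_eq_zero (l₀ : Fin P.d) (a : ℕ → (Fin (k + 1) → ℝ) → ℝ) {m : ℕ} (hm : m + 1 ≤ domCount P M (k + 1)) (g : Fin (k + 1) → ℝ) (φ : CPair P ℂ)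
    {X : (domSys P M (k + 1)).Dom} (hX : ∀ i ≤ m, X ≠ segDom (domCount P M (k + 1)) l₀ i) :
    (nestedStep P M k l₀ a m).E g φ X = 0 := by
  haveI : Std.Symm (tgeometry P.d (domCount P M (k + 1))).ι := ⟨ttouch_symm⟩
  unfold ClusterStep.E
  exact locE_chain_eq_zero (ι := (tgeometry P.d (domCount P M (k + 1))).ι) (tgeometry P.d (domCount P M (k + 1))).cubes _
    (segDom (domCount P M (k + 1)) l₀) m (fun Z hZ => H_nestedStep_eq_zero l₀ a m g φ hZ) (nestedStep_mono l₀ hm)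
    (fun i hi h => hX i hi (Subtype.ext h))

open Classical in
/-- **THE KOTECKÝ–PREISS LOGARITHM OF THE FIRST `j` NESTED POLYMERS**: they pairwise touch (share the cube `0`), so `log Z = Log(1 + 𝐔(b₀)·Σ_{i<j} a i g)` when that number
lies in the slit plane (`polymerLogZ_of_pairwise`). -/
theorem polymerLogZ_nestedStep (l₀ : Fin P.d) (a : ℕ → (Fin (k + 1) → ℝ) → ℝ) {m : ℕ} (hm : m + 1 ≤ domCount P M (k + 1)) (g : Fin (k + 1) → ℝ) (φ : CPair P ℂ)
    {j : ℕ} (hj : j ≤ m + 1) (hsl : 1 + φ.1 ⟨default, l₀⟩ * ((∑ i ∈ Finset.range j, a i g : ℝ) : ℂ) ∈ Complex.slitPlane) :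
    polymerLogZ (TTouch (d := P.d) (N := domCount P M (k + 1))) (fun Z => (nestedStep P M k l₀ a m).H g φ Z)
        ((Finset.range j).image (segDom (domCount P M (k + 1)) l₀)) =
      Complex.log (1 + φ.1 ⟨default, l₀⟩ * ((∑ i ∈ Finset.range j, a i g : ℝ) : ℂ)) := by
  have hsum : ∑ Z ∈ (Finset.range j).image (segDom (domCount P M (k + 1)) l₀), (nestedStep P M k l₀ a m).H g φ Z =
      φ.1 ⟨default, l₀⟩ * ((∑ i ∈ Finset.range j, a i g : ℝ) : ℂ) := by
    rw [Finset.sum_image fun _ hi _ hi' h => segDom_injOn l₀ hm (le_of_mem_range_of_le hi hj) (le_of_mem_range_of_le hi' hj) h,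
      Complex.ofReal_sum, Finset.mul_sum]
    exact Finset.sum_congr rfl fun _ hi => by
      rw [H_nestedStep_segDom l₀ a hm g φ (le_of_mem_range_of_le hi hj), mul_comm]
  rw [polymerLogZ_of_pairwise (fun Z hZ Z' hZ' _ => ?_), hsum]
  · rwa [hsum]
  · obtain ⟨i, -, rfl⟩ := Finset.mem_image.1 hZ
    obtain ⟨i', -, rfl⟩ := Finset.mem_image.1 hZ'
    exact ttouch_segDom l₀ i i'

/-- ★★ **THE (2.13) TERMS OF THE NESTED STEP AT A REAL POSITIVE PROBE VALUE, IN CLOSED FORM** (`a ≥ 0`, `𝐔(b₀) = x > 0`):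
`E(seg j) = log(1 + x Σ_{i ≤ j} a i g) − log(1 + x Σ_{i < j} a i g)` (a real number). -/
theorem E_nestedStep_segDom_ofReal (l₀ : Fin P.d) {a : ℕ → (Fin (k + 1) → ℝ) → ℝ} {m : ℕ} (hm : m + 1 ≤ domCount P M (k + 1)) (g : Fin (k + 1) → ℝ)
    (ha : ∀ i, 0 ≤ a i g) {φ : CPair P ℂ} {x : ℝ} (hx : 0 < x) (hφ : φ.1 ⟨default, l₀⟩ = (x : ℂ)) {j : ℕ} (hj : j ≤ m) :
    (nestedStep P M k l₀ a m).E g φ (segDom (domCount P M (k + 1)) l₀ j) =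
      ((Real.log (1 + x * ∑ i ∈ Finset.range (j + 1), a i g) - Real.log (1 + x * ∑ i ∈ Finset.range j, a i g) : ℝ) : ℂ) := by
  have hpos : ∀ j', 0 < 1 + x * ∑ i ∈ Finset.range j', a i g := fun j' =>
    add_pos_of_pos_of_nonneg one_pos (mul_nonneg hx.le (Finset.sum_nonneg fun i _ => ha i))
  have hsl : ∀ j', 1 + φ.1 ⟨default, l₀⟩ * ((∑ i ∈ Finset.range j', a i g : ℝ) : ℂ) ∈ Complex.slitPlane := fun j' => by
    rw [hφ, ← Complex.ofReal_mul, ← Complex.ofReal_one, ← Complex.ofReal_add]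
    exact Complex.ofReal_mem_slitPlane.2 (hpos j')
  rw [E_nestedStep_segDom l₀ a hm g φ hj, polymerLogZ_nestedStep l₀ a hm g φ (j := j + 1) (by omega) (hsl _),
    polymerLogZ_nestedStep l₀ a hm g φ (j := j) (by omega) (hsl _), hφ]
  push_cast
  rw [Complex.ofReal_log (hpos _).le, Complex.ofReal_log (hpos _).le]
  push_cast
  ring_nf

end Terms

end YMDAG.N22.AtKernels.NestedPolymers

end
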